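/-
Copyright (c) 2026. All rights reserved.
Released under Apache 2.0 license as described in the file LICENSE.
-/
import Literature.NumberTheory.PAdicHodge.SenDecompletionMatrix
import HarnessLib

/-!
# Sen–Tate decompletion for `GL_d` over an abstract Tate–Sen datum (Berger–Colmez, Lemme 3.2.3
# and Cor. 3.2.4 for a general closed subfield `A = Λ̃^H ⊆ ℂ_F`)

`SenDecompletionMatrix` runs Sen's successive-approximation argument over the completed cyclotomic
field `X = \widehat{K_∞} = ℂ_F^{H₀}` with Tate's normalised trace `R_n` and the generator `γ_n`.
Here we run the SAME argument over an abstract **Tate–Sen datum** (given as explicit hypotheses): a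
closed subfield `A ⊆ ℂ_F`, an element `γ ∈ G₀` with `γ A ⊆ A`, and a map `R : ℂ_F → ℂ_F` which on `A`
is a `γ`-invariant additive idempotent with values in `A`, satisfying Colmez's (TS2)
`‖R x‖ ≤ c₂ ‖x‖`, (TS3) `‖x − R x‖ ≤ c₃ ‖γ x − x‖` and Tate's surjectivity
`R v = 0 ⇒ v = γ c − c, R c = 0` (`c₂ ≥ 1`, `c₃ ≥ 0`).  The relative package
`TateTrace.exists_relTatePackage` (file `SenRelativeTatePackage`) says exactly that
`A = X_N = ℂ_F^{H_N}`, `γ = γ^N_n`, `R = R^N_n` is such a datum with `c₂ = ‖p‖^{-(k+1)}`,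
`c₃ = ‖p‖^{-(k+2)}`; the base case is `A = X`, `γ = γ_n`, `R = R_n`, `c₂ = ‖p‖⁻¹`, `c₃ = ‖p‖⁻²`.

## Main results

* `TateTrace.exists_conj_near_fixed_matrix_subfield` — **the contraction step (Berger–Colmez
  Lemme 3.2.3).** `U ∈ M_d(A)`, `Rr ∈ M_d(A)^{γ=1}`, `‖Rr‖ ≤ M`, `‖U − 1 − Rr‖ ≤ E`, `c₂E ≤ M`,
  `c₂c₃E < 1` ⟹ there are `C ∈ M_d(A)`, `‖C‖ ≤ c₂c₃E`, and a `γ`-fixed `Rr' ∈ M_d(A)`, `‖Rr'‖ ≤ M`,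
  `‖Rr' − Rr‖ ≤ c₂E`, with `U' = (1 + C)⁻¹ U γ(1 + C) ∈ M_d(A)` and `‖U' − 1 − Rr'‖ ≤ c₂c₃ M E`.
* ★ `TateTrace.exists_matrix_conj_fixed_subfield` — **decompletion of small cocycles
  (Berger–Colmez Cor. 3.2.4).** For a datum with `c₂ = ‖p‖^{-k₂}`, `c₃ = ‖p‖^{-k₃}` and `U ∈ M_d(A)`
  with `‖U − 1‖ ≤ ‖p‖^{2k₂+2k₃+1}` there is `B ∈ GL_d(A)`, `‖B − 1‖ ≤ ‖p‖^{k₂+1}`, `B⁻¹ ∈ M_d(A)`,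
  with `B⁻¹ U γ(B) ∈ M_d(A)` FIXED by `γ` entrywise.  (For `k₂ = 1`, `k₃ = 2` these are exactly the
  constants `‖p‖⁷`, `‖p‖²` of `TateTrace.exists_matrix_conj_fixed`.)

## Proof

Word for word `SenDecompletionMatrix` (whose ultrametric matrix toolkit is repeated here, the
lemmas there being private): `W = U − 1 − Rr`, `Rr' = Rr + R(W)`, `V₁ = W − R(W)` (so `R V₁ = 0`),
`C = −c'` with `γc' − c' = V₁`, `R c' = 0`, `‖c'‖ ≤ c₃‖V₁‖ ≤ c₂c₃E`, and the identity
`(1 + C)(U' − 1 − Rr') = (U − 1)γ(C) − C Rr'`; then the iteration `B_{k+1} = B_k(1 + C_k)` with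
`M = ‖p‖^{k₂+k₃+1}` (so `c₂c₃M = ‖p‖`), `E_k = ‖p‖^{2k₂+k₃+1} ‖p‖^k`, convergence in the complete field
`ℂ_F` with `A` closed, and continuity of inversion at the invertible limit. No named facts are used.

References: L. Berger, P. Colmez, *Familles de représentations de de Rham et monodromie p-adique*,
Astérisque 319 (2008), Déf. 3.1.3, Lemme 3.2.3 and Cor. 3.2.4 [BergerColmez2008]; J. Tate,
*p-divisible groups* (1967), §3.2 Prop. 7 [Tate1967]; O. Brinon, B. Conrad, *CMI Summer School notes
on p-adic Hodge theory* (2009), §14.1–§15.1 [BrinonConrad2009].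
-/

noncomputable section

open ValuativeRel Field UniformSpace Filter Topology Finset

open scoped IntermediateField

namespace Literature.NumberTheory.PAdicHodge

open Literature.NumberTheory.GaloisRepresentations
open Literature.NumberTheory.GaloisRepresentations.IsNonarchimedeanLocalField
open CyclotomicTower

variable {F : Type} [Field F] [ValuativeRel F] [TopologicalSpace F] [IsNonarchimedeanLocalField F]
  [CharZero F] {p : ℕ} [Fact p.Prime] (hp : valuation F p < 1)

namespace TateTrace

variable {m : Type} [Fintype m] [DecidableEq m]

/-! ### Ultrametric matrix toolkit over `ℂ_F` (as in `SenDecompletionMatrix`) -/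

omit [CharZero F] in
/-- `‖x + y‖ ≤ max ‖x‖ ‖y‖` in `ℂ_F`. [folklore] -/
private theorem norm_add_le_max' (x y : CompletedAlgClosure F) : ‖x + y‖ ≤ max ‖x‖ ‖y‖ :=
  IsUltrametricDist.norm_add_le_max x y

omit [CharZero F] in
/-- `‖x - y‖ ≤ max ‖x‖ ‖y‖` in `ℂ_F`. [folklore] -/
private theorem norm_sub_le_max' (x y : CompletedAlgClosure F) : ‖x - y‖ ≤ max ‖x‖ ‖y‖ := by
  rw [sub_eq_add_neg, ← norm_neg y]; exact IsUltrametricDist.norm_add_le_max x (-y)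

omit [CharZero F] in
/-- `‖1 + c‖ = 1` when `‖c‖ < 1`. [folklore] -/
private theorem norm_one_add_eq {c : CompletedAlgClosure F} (hc : ‖c‖ < 1) : ‖1 + c‖ = 1 := by
  have h := IsUltrametricDist.norm_add_eq_max_of_norm_ne_norm (x := (1 : CompletedAlgClosure F)) (y := c)
    (by rw [norm_one]; exact hc.ne')
  rw [h, norm_one, max_eq_left hc.le]

omit [CharZero F] [DecidableEq m] in
/-- Entrywise bounds are submultiplicative over the ultrametric field `ℂ_F`. [folklore] -/
private theorem norm_mul_apply_le {A B : Matrix m m (CompletedAlgClosure F)} {a b : ℝ} (ha : 0 ≤ a)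
    (hb : 0 ≤ b) (hA : ∀ i j, ‖A i j‖ ≤ a) (hB : ∀ i j, ‖B i j‖ ≤ b) (i j : m) :
    ‖(A * B) i j‖ ≤ a * b := by
  rw [Matrix.mul_apply]
  exact IsUltrametricDist.norm_sum_le_of_forall_le_of_nonneg (mul_nonneg ha hb)
    fun k _ => by rw [norm_mul]; exact mul_le_mul (hA i k) (hB k j) (norm_nonneg _) ha

omit [CharZero F] [Fintype m] [DecidableEq m] in
/-- `‖(A - B) i j‖ ≤ max`. [folklore] -/
private theorem norm_sub_apply_le {A B : Matrix m m (CompletedAlgClosure F)} {a b : ℝ}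
    (hA : ∀ i j, ‖A i j‖ ≤ a) (hB : ∀ i j, ‖B i j‖ ≤ b) (i j : m) :
    ‖(A - B) i j‖ ≤ max a b := by
  rw [Matrix.sub_apply]
  exact (norm_sub_le_max' _ _).trans (max_le_max (hA i j) (hB i j))

omit [CharZero F] [Fintype m] [DecidableEq m] in
/-- `‖(A + B) i j‖ ≤ max`. [folklore] -/
private theorem norm_add_apply_le {A B : Matrix m m (CompletedAlgClosure F)} {a b : ℝ}
    (hA : ∀ i j, ‖A i j‖ ≤ a) (hB : ∀ i j, ‖B i j‖ ≤ b) (i j : m) :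
    ‖(A + B) i j‖ ≤ max a b := by
  rw [Matrix.add_apply]
  exact (norm_add_le_max' _ _).trans (max_le_max (hA i j) (hB i j))

omit [CharZero F] in
/-- The determinant of a matrix with entries of norm `≤ 1` has norm `≤ 1`. [folklore] -/
private theorem norm_det_le_one {A : Matrix m m (CompletedAlgClosure F)} (hA : ∀ i j, ‖A i j‖ ≤ 1) :
    ‖A.det‖ ≤ 1 := by
  rw [Matrix.det_apply']
  refine IsUltrametricDist.norm_sum_le_of_forall_le_of_nonneg zero_le_one fun σ _ => ?_
  have h1 : ‖(((Equiv.Perm.sign σ : ℤˣ) : ℤ) : CompletedAlgClosure F)‖ = 1 := by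
    rcases Int.units_eq_one_or (Equiv.Perm.sign σ) with h | h <;> simp [h]
  rw [norm_mul, h1, one_mul, norm_prod]
  exact Finset.prod_le_one (fun i _ => norm_nonneg _) fun i _ => hA _ _

omit [CharZero F] [Fintype m] in
/-- Entries of `1 + C`, `‖C‖ ≤ r ≤ 1`: norm `≤ 1`, and the off-diagonal ones `≤ r`. [folklore] -/
private theorem norm_one_add_apply_le {C : Matrix m m (CompletedAlgClosure F)} {r : ℝ} (hr1 : r ≤ 1)
    (hC : ∀ i j, ‖C i j‖ ≤ r) (i j : m) :
    ‖(1 + C : Matrix m m (CompletedAlgClosure F)) i j‖ ≤ 1 ∧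
      (i ≠ j → ‖(1 + C : Matrix m m (CompletedAlgClosure F)) i j‖ ≤ r) := by
  rw [Matrix.add_apply]
  by_cases hij : i = j
  · subst hij
    rw [Matrix.one_apply_eq]
    refine ⟨(norm_add_le_max' _ _).trans ?_, fun h => (h rfl).elim⟩
    rw [norm_one]; exact max_le le_rfl ((hC i i).trans hr1)
  · rw [Matrix.one_apply_ne hij, zero_add]
    exact ⟨(hC i j).trans hr1, fun _ => hC i j⟩

omit [CharZero F] [Fintype m] in
/-- `‖∏ (1 + c_i) − 1‖ ≤ r` when all `‖c_i‖ ≤ r ≤ 1`. [folklore] -/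
private theorem norm_prod_one_add_sub_one_le {s : Finset m} {c : m → CompletedAlgClosure F} {r : ℝ}
    (hr0 : 0 ≤ r) (hr1 : r ≤ 1) (hc : ∀ i, ‖c i‖ ≤ r) : ‖∏ i ∈ s, (1 + c i) - 1‖ ≤ r := by
  induction s using Finset.induction_on with
  | empty => rw [Finset.prod_empty, sub_self, norm_zero]; exact hr0
  | @insert a s ha ih =>
    rw [Finset.prod_insert ha]
    set P := ∏ i ∈ s, (1 + c i)
    have hP : ‖P‖ ≤ 1 := by
      have h := norm_add_le_max' (P - 1) 1
      rw [sub_add_cancel, norm_one] at h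
      exact h.trans (max_le (ih.trans hr1) le_rfl)
    have h : (1 + c a) * P - 1 = (P - 1) + c a * P := by ring
    rw [h]
    refine (norm_add_le_max' _ _).trans (max_le ih ?_)
    rw [norm_mul]
    calc ‖c a‖ * ‖P‖ ≤ r * 1 := mul_le_mul (hc a) hP (norm_nonneg _) hr0
      _ = r := mul_one r

omit [CharZero F] in
/-- `‖det(1 + C) − 1‖ ≤ ‖C‖` for `‖C‖ < 1` (Leibniz expansion). [folklore] -/
private theorem norm_det_one_add_sub_one_le {C : Matrix m m (CompletedAlgClosure F)} {r : ℝ}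
    (hr0 : 0 ≤ r) (hr1 : r < 1) (hC : ∀ i j, ‖C i j‖ ≤ r) :
    ‖(1 + C : Matrix m m (CompletedAlgClosure F)).det - 1‖ ≤ r := by
  have hent := norm_one_add_apply_le hr1.le hC
  rw [Matrix.det_apply', ← Finset.sum_erase_add _ _ (Finset.mem_univ (1 : Equiv.Perm m))]
  simp only [Equiv.Perm.sign_one, Units.val_one, Int.cast_one, one_mul, Equiv.Perm.one_apply]
  rw [add_sub_assoc]
  refine (norm_add_le_max' _ _).trans (max_le ?_ ?_)
  · refine IsUltrametricDist.norm_sum_le_of_forall_le_of_nonneg hr0 fun σ hσ => ?_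
    have hσ1 : σ ≠ 1 := Finset.ne_of_mem_erase hσ
    obtain ⟨i₀, hi₀⟩ : ∃ i, σ i ≠ i := not_forall.mp fun h => hσ1 (Equiv.ext h)
    have h1 : ‖(((Equiv.Perm.sign σ : ℤˣ) : ℤ) : CompletedAlgClosure F)‖ = 1 := by
      rcases Int.units_eq_one_or (Equiv.Perm.sign σ) with h | h <;> simp [h]
    rw [norm_mul, h1, one_mul, ← Finset.prod_erase_mul _ _ (Finset.mem_univ i₀), norm_mul]
    calc ‖∏ i ∈ Finset.univ.erase i₀, (1 + C : Matrix m m (CompletedAlgClosure F)) (σ i) i‖ *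
          ‖(1 + C : Matrix m m (CompletedAlgClosure F)) (σ i₀) i₀‖ ≤ 1 * r := by
          refine mul_le_mul ?_ ((hent _ _).2 hi₀) (norm_nonneg _) zero_le_one
          rw [norm_prod]
          exact Finset.prod_le_one (fun i _ => norm_nonneg _) fun i _ => (hent _ _).1
      _ = r := one_mul r
  · simp only [Matrix.add_apply, Matrix.one_apply_eq]
    exact norm_prod_one_add_sub_one_le hr0 hr1.le fun i => hC i i

omit [CharZero F] in
/-- `1 + C` is invertible for `‖C‖ < 1`, with `‖det(1 + C)‖ = 1`. [folklore] -/
private theorem norm_det_one_add_eq_one {C : Matrix m m (CompletedAlgClosure F)} {r : ℝ}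
    (hr0 : 0 ≤ r) (hr1 : r < 1) (hC : ∀ i j, ‖C i j‖ ≤ r) :
    ‖(1 + C : Matrix m m (CompletedAlgClosure F)).det‖ = 1 := by
  have h := norm_det_one_add_sub_one_le hr0 hr1 hC
  have h1 : (1 + C : Matrix m m (CompletedAlgClosure F)).det =
      1 + ((1 + C : Matrix m m (CompletedAlgClosure F)).det - 1) := by ring
  rw [h1]
  exact norm_one_add_eq (h.trans_lt hr1)

omit [CharZero F] in
/-- `B` with `‖B − 1‖ ≤ r < 1` entrywise has `‖det B‖ = 1`, so is invertible. [folklore] -/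
private theorem isUnit_det_of_norm_sub_one_le {B : Matrix m m (CompletedAlgClosure F)} {r : ℝ}
    (hr0 : 0 ≤ r) (hr1 : r < 1) (hB : ∀ i j, ‖(B - 1) i j‖ ≤ r) : IsUnit B.det := by
  have h := norm_det_one_add_eq_one hr0 hr1 hB
  rw [add_sub_cancel] at h
  refine isUnit_iff_ne_zero.mpr fun h0 => ?_
  rw [h0, norm_zero] at h
  exact zero_ne_one h

omit [CharZero F] in
/-- `‖(1 + C)⁻¹‖ ≤ 1` for `‖C‖ < 1` (adjugate formula). [folklore] -/
private theorem norm_inv_one_add_apply_le {C : Matrix m m (CompletedAlgClosure F)} {r : ℝ}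
    (hr0 : 0 ≤ r) (hr1 : r < 1) (hC : ∀ i j, ‖C i j‖ ≤ r) (i j : m) :
    ‖(1 + C : Matrix m m (CompletedAlgClosure F))⁻¹ i j‖ ≤ 1 := by
  have hdet := norm_det_one_add_eq_one hr0 hr1 hC
  have hent := norm_one_add_apply_le hr1.le hC
  rw [Matrix.inv_def, Matrix.smul_apply, smul_eq_mul, Ring.inverse_eq_inv, norm_mul, norm_inv, hdet,
    inv_one, one_mul, Matrix.adjugate_apply]
  refine norm_det_le_one fun i' j' => ?_
  rw [Matrix.updateRow_apply]
  split_ifs with h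
  · by_cases hij : j' = i
    · subst hij; rw [Pi.single_eq_same, norm_one]
    · rw [Pi.single_eq_of_ne hij, norm_zero]; exact zero_le_one
  · exact (hent _ _).1

/-- `‖g y − y‖ ≤ ‖y‖` (`g ∈ G₀` is an isometry of `ℂ_F`). [folklore] -/
private theorem norm_smul_sub_le' (g : BaseGaloisGroup hp) (y : CompletedAlgClosure F) :
    ‖g • y - y‖ ≤ ‖y‖ := by
  refine (norm_sub_le_max' _ _).trans (max_le (le_of_eq ?_) le_rfl)
  exact CompletedAlgClosure.norm_base_smul hp g y

omit [Fintype m] in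
/-- `g` fixes the entries of the identity matrix. [folklore] -/
private theorem smul_one_apply' (g : BaseGaloisGroup hp) (i j : m) :
    g • (1 : Matrix m m (CompletedAlgClosure F)) i j = (1 : Matrix m m (CompletedAlgClosure F)) i j := by
  rw [Matrix.one_apply]
  split_ifs
  · exact smul_one g
  · exact smul_zero g

omit [CharZero F] in
/-- `(B(1+C))⁻¹ · U · f(B(1+C)) = (1+C)⁻¹ · (B⁻¹ U f(B)) · (1 + f(C))` for a ring endomorphism `f`
applied entrywise. [folklore] -/
private theorem conj_mul_one_add' (f : CompletedAlgClosure F →+* CompletedAlgClosure F)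
    (U B C : Matrix m m (CompletedAlgClosure F)) :
    (B * (1 + C))⁻¹ * U * (B * (1 + C)).map f = (1 + C)⁻¹ * (B⁻¹ * U * B.map f) * (1 + C.map f) := by
  rw [Matrix.mul_inv_rev, Matrix.map_mul, Matrix.map_add f (map_add f),
    Matrix.map_one f (map_zero f) (map_one f)]
  simp only [Matrix.mul_assoc]

/-! ### Matrices with entries in a subfield `A ⊆ ℂ_F` -/

omit [CharZero F] [DecidableEq m] in
/-- Products of matrices over `A` are over `A`. [folklore] -/
private theorem mul_apply_memA (A : Subfield (CompletedAlgClosure F)) {M N : Matrix m m (CompletedAlgClosure F)}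
    (hM : ∀ i j, M i j ∈ A) (hN : ∀ i j, N i j ∈ A) (i j : m) : (M * N) i j ∈ A := by
  rw [Matrix.mul_apply]
  exact sum_mem fun k _ => mul_mem (hM i k) (hN k j)

omit [CharZero F] [Fintype m] [DecidableEq m] in
/-- Sums of matrices over `A` are over `A`. [folklore] -/
private theorem add_apply_memA (A : Subfield (CompletedAlgClosure F)) {M N : Matrix m m (CompletedAlgClosure F)}
    (hM : ∀ i j, M i j ∈ A) (hN : ∀ i j, N i j ∈ A) (i j : m) : (M + N) i j ∈ A := by
  rw [Matrix.add_apply]; exact add_mem (hM i j) (hN i j)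

omit [CharZero F] [Fintype m] [DecidableEq m] in
/-- Differences of matrices over `A` are over `A`. [folklore] -/
private theorem sub_apply_memA (A : Subfield (CompletedAlgClosure F)) {M N : Matrix m m (CompletedAlgClosure F)}
    (hM : ∀ i j, M i j ∈ A) (hN : ∀ i j, N i j ∈ A) (i j : m) : (M - N) i j ∈ A := by
  rw [Matrix.sub_apply]; exact sub_mem (hM i j) (hN i j)

omit [CharZero F] [Fintype m] in
/-- `1 ∈ M_d(A)`. [folklore] -/
private theorem one_apply_memA (A : Subfield (CompletedAlgClosure F)) (i j : m) :
    (1 : Matrix m m (CompletedAlgClosure F)) i j ∈ A := by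
  rw [Matrix.one_apply]
  split_ifs
  · exact one_mem A
  · exact zero_mem A

omit [Fintype m] [DecidableEq m] in
/-- `g(M) ∈ M_d(A)` when `g A ⊆ A`. [folklore] -/
private theorem map_smul_apply_memA (A : Subfield (CompletedAlgClosure F)) {g : BaseGaloisGroup hp}
    (hg : ∀ x ∈ A, g • x ∈ A) {M : Matrix m m (CompletedAlgClosure F)} (hM : ∀ i j, M i j ∈ A) (i j : m) :
    (M.map fun x => g • x) i j ∈ A := by
  rw [Matrix.map_apply]; exact hg _ (hM i j)

omit [CharZero F] in
/-- The inverse of a matrix over the subfield `A` is over `A`. [folklore] -/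
private theorem inv_apply_memA (A : Subfield (CompletedAlgClosure F)) {M : Matrix m m (CompletedAlgClosure F)}
    (hM : ∀ i j, M i j ∈ A) (i j : m) : M⁻¹ i j ∈ A := by
  set M' : Matrix m m A := fun i j => ⟨M i j, hM i j⟩ with hM'
  have hMM' : A.subtype.mapMatrix M' = M := by
    ext i j; rfl
  have hdet : M.det ∈ A := by
    rw [← hMM', ← RingHom.map_det]
    exact (M'.det).2
  have hadj : M.adjugate i j ∈ A := by
    rw [← hMM', ← RingHom.map_adjugate]
    exact (M'.adjugate i j).2
  rw [Matrix.inv_def, Matrix.smul_apply, smul_eq_mul, Ring.inverse_eq_inv]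
  exact mul_mem (inv_mem hdet) hadj

/-! ### The contraction step (Berger–Colmez, Lemme 3.2.3) over a Tate–Sen datum -/

/-- **Berger–Colmez, Lemme 3.2.3 over a Tate–Sen datum `(A, γ, R, c₂, c₃)`** — a subfield
`A ⊆ ℂ_F` with `γ A ⊆ A` and a map `R` which on `A` is a `γ`-invariant additive idempotent with values
in `A`, (TS2) `‖R x‖ ≤ c₂‖x‖` (`c₂ ≥ 1`), (TS3) `‖x − R x‖ ≤ c₃‖γ x − x‖` (`c₃ ≥ 0`) and Tate's
surjectivity `R v = 0 ⇒ v = γc − c, R c = 0`.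
`U ∈ M_d(A)`, `Rr ∈ M_d(A)^{γ=1}`, `‖Rr‖ ≤ M`, `‖U − 1 − Rr‖ ≤ E`, `c₂E ≤ M`, `c₂c₃E < 1` (entrywise
sup norms). Then there are `C ∈ M_d(A)` with `‖C‖ ≤ c₂c₃E` and a `γ`-fixed `Rr' ∈ M_d(A)` with
`‖Rr'‖ ≤ M`, `‖Rr' − Rr‖ ≤ c₂E`, such that `U' = (1 + C)⁻¹ U γ(1 + C) ∈ M_d(A)` and
`‖U' − 1 − Rr'‖ ≤ c₂c₃ M E`. [cite: BergerColmez2008, Lemme 3.2.3] [cite: Tate1967, §3.2 Prop. 7] -/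
theorem exists_conj_near_fixed_matrix_subfield {A : Subfield (CompletedAlgClosure F)}
    {γ : BaseGaloisGroup hp} {R : CompletedAlgClosure F → CompletedAlgClosure F} {c₂ c₃ : ℝ}
    (hγA : ∀ x ∈ A, γ • x ∈ A) (hRA : ∀ x ∈ A, R x ∈ A) (hγR : ∀ x ∈ A, γ • R x = R x)
    (hRR : ∀ x ∈ A, R (R x) = R x) (hRsub : ∀ x ∈ A, ∀ y ∈ A, R (x - y) = R x - R y)
    (hc₂ : 1 ≤ c₂) (hc₃ : 0 ≤ c₃) (hR₂ : ∀ x ∈ A, ‖R x‖ ≤ c₂ * ‖x‖)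
    (hR₃ : ∀ x ∈ A, ‖x - R x‖ ≤ c₃ * ‖γ • x - x‖)
    (hRsurj : ∀ v ∈ A, R v = 0 → ∃ c ∈ A, R c = 0 ∧ γ • c - c = v)
    {U Rr : Matrix m m (CompletedAlgClosure F)}
    (hU : ∀ i j, U i j ∈ A) (hRr : ∀ i j, Rr i j ∈ A) (hγRr : ∀ i j, γ • Rr i j = Rr i j)
    {M E : ℝ} (hRrM : ∀ i j, ‖Rr i j‖ ≤ M) (hEM : c₂ * E ≤ M) (hE3 : c₂ * c₃ * E < 1)
    (hE : ∀ i j, ‖(U - 1 - Rr) i j‖ ≤ E) :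
    ∃ C : Matrix m m (CompletedAlgClosure F), (∀ i j, C i j ∈ A) ∧
      (∀ i j, ‖C i j‖ ≤ c₂ * c₃ * E) ∧
      ∃ Rr' : Matrix m m (CompletedAlgClosure F), (∀ i j, Rr' i j ∈ A) ∧
        (∀ i j, γ • Rr' i j = Rr' i j) ∧ (∀ i j, ‖Rr' i j‖ ≤ M) ∧
        (∀ i j, ‖(Rr' - Rr) i j‖ ≤ c₂ * E) ∧
        (∀ i j, ((1 + C)⁻¹ * U * (1 + C.map fun x => γ • x)) i j ∈ A) ∧
        ∀ i j, ‖((1 + C)⁻¹ * U * (1 + C.map fun x => γ • x) - 1 - Rr') i j‖ ≤ c₂ * c₃ * M * E := by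
  rcases isEmpty_or_nonempty m with hm | ⟨⟨i₀⟩⟩
  · exact ⟨0, fun i => isEmptyElim i, fun i => isEmptyElim i, 0, fun i => isEmptyElim i,
      fun i => isEmptyElim i, fun i => isEmptyElim i, fun i => isEmptyElim i, fun i => isEmptyElim i,
      fun i => isEmptyElim i⟩
  have hE0 : 0 ≤ E := (norm_nonneg _).trans (hE i₀ i₀)
  have hc20 : 0 ≤ c₂ := zero_le_one.trans hc₂
  have hc30 : 0 ≤ c₃ := hc₃
  have hEE : E ≤ c₂ * E := le_mul_of_one_le_left hE0 hc₂
  have hEM' : E ≤ M := hEE.trans hEM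
  have hM0 : 0 ≤ M := (norm_nonneg _).trans (hRrM i₀ i₀)
  -- the data `W = U − 1 − Rr`, `Rw = R(W)`, `V₁ = W − Rw`
  have hW : ∀ i j, (U - 1 - Rr) i j ∈ A :=
    sub_apply_memA A (sub_apply_memA A hU (one_apply_memA A)) hRr
  set Rw : Matrix m m (CompletedAlgClosure F) := fun i j => R ((U - 1 - Rr) i j) with hRw_def
  have hRw_apply : ∀ i j, Rw i j = R ((U - 1 - Rr) i j) := fun i j => rfl
  have hRwA : ∀ i j, Rw i j ∈ A := fun i j => by rw [hRw_apply]; exact hRA _ (hW i j)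
  have hγRw : ∀ i j, γ • Rw i j = Rw i j := fun i j => by
    rw [hRw_apply]; exact hγR _ (hW i j)
  have hRw_norm : ∀ i j, ‖Rw i j‖ ≤ c₂ * E := fun i j => by
    rw [hRw_apply]
    exact (hR₂ _ (hW i j)).trans (mul_le_mul_of_nonneg_left (hE i j) hc20)
  have hV₁A : ∀ i j, (U - 1 - Rr - Rw) i j ∈ A := sub_apply_memA A hW hRwA
  have hRV₁ : ∀ i j, R ((U - 1 - Rr - Rw) i j) = 0 := by
    intro i j
    rw [Matrix.sub_apply (U - 1 - Rr) Rw, hRsub _ (hW i j) _ (hRwA i j), hRw_apply,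
      hRR _ (hW i j), sub_self]
  have hV₁norm : ∀ i j, ‖(U - 1 - Rr - Rw) i j‖ ≤ c₂ * E := fun i j =>
    (norm_sub_apply_le hE hRw_norm i j).trans (max_le hEE le_rfl)
  -- Tate's surjectivity, entrywise: `γ c' − c' = V₁`, `R c' = 0`, `‖c'‖ ≤ c₃ ‖V₁‖ ≤ c₂ c₃ E`
  choose c' hc'A hRc' hc'eq using fun i j => hRsurj _ (hV₁A i j) (hRV₁ i j)
  have hc'norm : ∀ i j, ‖c' i j‖ ≤ c₂ * c₃ * E := by
    intro i j
    have h := hR₃ _ (hc'A i j)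
    rw [hRc', sub_zero, hc'eq] at h
    refine h.trans ?_
    calc c₃ * ‖(U - 1 - Rr - Rw) i j‖ ≤ c₃ * (c₂ * E) := mul_le_mul_of_nonneg_left (hV₁norm i j) hc30
      _ = c₂ * c₃ * E := by ring
  -- `C = −c'`, `Rr' = Rr + Rw`
  set C : Matrix m m (CompletedAlgClosure F) := fun i j => -c' i j with hC_def
  have hC_apply : ∀ i j, C i j = -c' i j := fun i j => rfl
  have hCA : ∀ i j, C i j ∈ A := fun i j => by rw [hC_apply]; exact neg_mem (hc'A i j)
  have hCn : ∀ i j, ‖C i j‖ ≤ c₂ * c₃ * E := fun i j => by rw [hC_apply, norm_neg]; exact hc'norm i j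
  have hr0 : 0 ≤ c₂ * c₃ * E := mul_nonneg (mul_nonneg hc20 hc30) hE0
  have hCγA : ∀ i j, (C.map fun x => γ • x) i j ∈ A := map_smul_apply_memA hp A hγA hCA
  have hCγn : ∀ i j, ‖(C.map fun x => γ • x) i j‖ ≤ c₂ * c₃ * E := fun i j => by
    rw [Matrix.map_apply, CompletedAlgClosure.norm_base_smul hp]; exact hCn i j
  have hRr'A : ∀ i j, (Rr + Rw) i j ∈ A := add_apply_memA A hRr hRwA
  have hγRr' : ∀ i j, γ • (Rr + Rw) i j = (Rr + Rw) i j := fun i j => by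
    rw [Matrix.add_apply, smul_add, hγRr, hγRw]
  have hRr'M : ∀ i j, ‖(Rr + Rw) i j‖ ≤ M := fun i j =>
    (norm_add_apply_le hRrM hRw_norm i j).trans (max_le le_rfl hEM)
  have hdet : IsUnit (1 + C : Matrix m m (CompletedAlgClosure F)).det := by
    refine isUnit_det_of_norm_sub_one_le hr0 hE3 (B := 1 + C) fun i j => ?_
    rw [add_sub_cancel_left]; exact hCn i j
  refine ⟨C, hCA, hCn, Rr + Rw, hRr'A, hγRr', hRr'M, fun i j => ?_, ?_, ?_⟩
  · rw [add_sub_cancel_left]; exact hRw_norm i j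
  · exact mul_apply_memA A (mul_apply_memA A (inv_apply_memA A (add_apply_memA A
      (one_apply_memA A) hCA)) hU) (add_apply_memA A (one_apply_memA A) hCγA)
  -- the exact identity `(1 + C)(U' − 1 − Rr') = (U − 1) γ(C) − C Rr'`
  have hγC : (C.map fun x => γ • x) = C - (U - 1 - Rr - Rw) := by
    ext i j
    rw [Matrix.map_apply, Matrix.sub_apply, hC_apply, smul_neg, ← hc'eq i j]
    ring
  have hid : (1 + C)⁻¹ * U * (1 + C.map fun x => γ • x) - 1 - (Rr + Rw) =
      (1 + C)⁻¹ * ((U - 1) * (C.map fun x => γ • x) - C * (Rr + Rw)) := by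
    have h1 : (1 + C)⁻¹ * U * (1 + C.map fun x => γ • x) - 1 - (Rr + Rw) =
        (1 + C)⁻¹ * ((1 + C) * ((1 + C)⁻¹ * U * (1 + C.map fun x => γ • x) - 1 - (Rr + Rw))) :=
      (Matrix.nonsing_inv_mul_cancel_left (1 + C) _ hdet).symm
    rw [h1]
    congr 1
    have h2 : (1 + C) * ((1 + C)⁻¹ * U * (1 + C.map fun x => γ • x)) =
        U * (1 + C.map fun x => γ • x) := by
      rw [Matrix.mul_assoc, Matrix.mul_nonsing_inv_cancel_left (1 + C) _ hdet]
    rw [Matrix.mul_sub, Matrix.mul_sub, h2, hγC]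
    noncomm_ring
  intro i j
  rw [hid]
  have hV : ∀ i j, ‖(U - 1) i j‖ ≤ M := by
    intro i j
    have h : (U - 1) i j = (U - 1 - Rr) i j + Rr i j := by
      rw [Matrix.sub_apply (U - 1) Rr, sub_add_cancel]
    rw [h]
    exact (norm_add_le_max' _ _).trans (max_le ((hE i j).trans hEM') (hRrM i j))
  have hinner : ∀ i j, ‖((U - 1) * (C.map fun x => γ • x) - C * (Rr + Rw)) i j‖ ≤
      c₂ * c₃ * M * E := by
    intro i j
    refine (norm_sub_apply_le (norm_mul_apply_le hM0 hr0 hV hCγn) (norm_mul_apply_le hr0 hM0 hCn hRr'M)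
      i j).trans (max_le (le_of_eq (by ring)) (le_of_eq (by ring)))
  calc ‖((1 + C)⁻¹ * ((U - 1) * (C.map fun x => γ • x) - C * (Rr + Rw))) i j‖
        ≤ 1 * (c₂ * c₃ * M * E) :=
        norm_mul_apply_le zero_le_one (mul_nonneg (mul_nonneg (mul_nonneg hc20 hc30) hM0) hE0)
          (norm_inv_one_add_apply_le hr0 hE3 hCn) hinner i j
    _ = c₂ * c₃ * M * E := one_mul _

/-! ### The decompletion theorem (Berger–Colmez, Cor. 3.2.4) over a Tate–Sen datum -/

/-- ★ **Berger–Colmez, Cor. 3.2.4 over a Tate–Sen datum with `c₂ = ‖p‖^{-k₂}`, `c₃ = ‖p‖^{-k₃}`: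
decompletion of small cocycles for `GL_d`.**  For `U ∈ M_d(A)` with `‖U − 1‖ ≤ ‖p‖^{2k₂+2k₃+1}`
(entrywise) there is `B ∈ M_d(A)` with `‖B − 1‖ ≤ ‖p‖^{k₂+1} < 1`, `det B` a unit and
`B⁻¹ ∈ M_d(A)`, such that `B⁻¹ · U · γ(B) ∈ M_d(A)` is fixed by `γ` entrywise. Proof: successive
approximation by `exists_conj_near_fixed_matrix_subfield` with `M = ‖p‖^{k₂+k₃+1}`,
`E_k = ‖p‖^{2k₂+k₃+1}‖p‖^k`, convergence of `B_k = (1 + C₀)⋯(1 + C_{k−1})` in `ℂ_F` with `A` closed,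
continuity of matrix inversion at the invertible limit.
[cite: BergerColmez2008, Cor. 3.2.4] [cite: Tate1967, §3.2 Prop. 7] -/
theorem exists_matrix_conj_fixed_subfield {A : Subfield (CompletedAlgClosure F)}
    (hAc : IsClosed (A : Set (CompletedAlgClosure F)))
    {γ : BaseGaloisGroup hp} {R : CompletedAlgClosure F → CompletedAlgClosure F} {k₂ k₃ : ℕ}
    (hγA : ∀ x ∈ A, γ • x ∈ A) (hRA : ∀ x ∈ A, R x ∈ A) (hγR : ∀ x ∈ A, γ • R x = R x)
    (hRR : ∀ x ∈ A, R (R x) = R x) (hRsub : ∀ x ∈ A, ∀ y ∈ A, R (x - y) = R x - R y)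
    (hR₂ : ∀ x ∈ A, ‖R x‖ ≤ ‖(p : PadicBase F p hp)‖⁻¹ ^ k₂ * ‖x‖)
    (hR₃ : ∀ x ∈ A, ‖x - R x‖ ≤ ‖(p : PadicBase F p hp)‖⁻¹ ^ k₃ * ‖γ • x - x‖)
    (hRsurj : ∀ v ∈ A, R v = 0 → ∃ c ∈ A, R c = 0 ∧ γ • c - c = v)
    {U : Matrix m m (CompletedAlgClosure F)} (hU : ∀ i j, U i j ∈ A)
    (hU1 : ∀ i j, ‖(U - 1) i j‖ ≤ ‖(p : PadicBase F p hp)‖ ^ (2 * k₂ + 2 * k₃ + 1)) :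
    ∃ B : Matrix m m (CompletedAlgClosure F), (∀ i j, B i j ∈ A) ∧
      (∀ i j, ‖(B - 1) i j‖ ≤ ‖(p : PadicBase F p hp)‖ ^ (k₂ + 1)) ∧ IsUnit B.det ∧
      (∀ i j, B⁻¹ i j ∈ A) ∧
      (∀ i j, (B⁻¹ * U * B.map fun x => γ • x) i j ∈ A) ∧
      ∀ i j, γ • (B⁻¹ * U * B.map fun x => γ • x) i j =
        (B⁻¹ * U * B.map fun x => γ • x) i j := by
  set π : ℝ := ‖(p : PadicBase F p hp)‖ with hπ
  have hπ0 : 0 < π := norm_pos_iff.mpr (by exact_mod_cast (Fact.out : p.Prime).ne_zero)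
  have hπ1 : π < 1 := PadicBase.norm_p_lt_one hp
  have hπne : π ≠ 0 := hπ0.ne'
  have hπle1 : π ≤ 1 := hπ1.le
  have hπpow : ∀ {a b : ℕ}, a ≤ b → π ^ b ≤ π ^ a := fun h => pow_le_pow_of_le_one hπ0.le hπle1 h
  have hδ1 : π ^ (k₂ + 1) < 1 := pow_lt_one₀ hπ0.le hπ1 (Nat.succ_ne_zero _)
  have hδ0 : 0 ≤ π ^ (k₂ + 1) := pow_nonneg hπ0.le _
  have hπi1 : 1 ≤ π⁻¹ := one_le_inv_iff₀.mpr ⟨hπ0, hπle1⟩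
  have hc₂ : 1 ≤ π⁻¹ ^ k₂ := one_le_pow₀ hπi1
  have hc₃ : 0 ≤ π⁻¹ ^ k₃ := pow_nonneg (inv_nonneg.mpr hπ0.le) _
  -- numerology of the constants `c₂ = π^{-k₂}`, `c₃ = π^{-k₃}`, `M = π^{k₂+k₃+1}`, `E₀ = π^{2k₂+k₃+1}`
  have num1 : ∀ k : ℕ, π⁻¹ ^ k₂ * (π ^ (2 * k₂ + k₃ + 1) * π ^ k) = π ^ (k₂ + k₃ + 1) * π ^ k := by
    intro k; rw [inv_pow]; field_simp; ring
  have num2 : ∀ k : ℕ, π⁻¹ ^ k₂ * π⁻¹ ^ k₃ * (π ^ (2 * k₂ + k₃ + 1) * π ^ k) = π ^ (k₂ + 1) * π ^ k := by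
    intro k; rw [inv_pow, inv_pow]; field_simp; ring
  have num3 : ∀ k : ℕ, π⁻¹ ^ k₂ * π⁻¹ ^ k₃ * π ^ (k₂ + k₃ + 1) * (π ^ (2 * k₂ + k₃ + 1) * π ^ k) =
      π ^ (2 * k₂ + k₃ + 1) * π ^ (k + 1) := by
    intro k; rw [inv_pow, inv_pow]; field_simp; ring
  have num4 : π⁻¹ ^ k₂ * π ^ (2 * k₂ + 2 * k₃ + 1) = π ^ (k₂ + 2 * k₃ + 1) := by
    rw [inv_pow]; field_simp; ring
  have num5 : π⁻¹ ^ k₃ * π ^ (2 * k₂ + 2 * k₃ + 1) = π ^ (2 * k₂ + k₃ + 1) := by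
    rw [inv_pow]; field_simp; ring
  -- the entrywise action of `γ` as a ring endomorphism
  set f : CompletedAlgClosure F →+* CompletedAlgClosure F :=
    MulSemiringAction.toRingHom (BaseGaloisGroup hp) (CompletedAlgClosure F) γ with hf_def
  have hf : (fun x : CompletedAlgClosure F => γ • x) = ⇑f := by
    funext x; simp [hf_def]
  have hγcont : Continuous (f : CompletedAlgClosure F → CompletedAlgClosure F) := by
    rw [← hf]; exact CompletedAlgClosure.continuous_base_smul hp γ
  rw [hf]
  -- `U_B = B⁻¹ U γ(B)` has entries in `A` as soon as `B` does
  have hUB : ∀ B : Matrix m m (CompletedAlgClosure F), (∀ i j, B i j ∈ A) →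
      ∀ i j, (B⁻¹ * U * B.map f) i j ∈ A := fun B hB =>
    mul_apply_memA A (mul_apply_memA A (inv_apply_memA A hB) hU)
      (by rw [← hf]; exact map_smul_apply_memA hp A hγA hB)
  -- `‖B‖ ≤ 1` when `‖B − 1‖ ≤ π^{k₂+1}`
  have hBle1 : ∀ B : Matrix m m (CompletedAlgClosure F), (∀ i j, ‖(B - 1) i j‖ ≤ π ^ (k₂ + 1)) →
      ∀ i j, ‖B i j‖ ≤ 1 := by
    intro B hB i j
    have h := (norm_one_add_apply_le hδ1.le hB i j).1
    rwa [add_sub_cancel] at h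
  -- the invariant of the iteration, on states `(B, Rr)`
  let I : ℕ → Matrix m m (CompletedAlgClosure F) × Matrix m m (CompletedAlgClosure F) → Prop :=
    fun k s => (∀ i j, s.1 i j ∈ A) ∧ (∀ i j, ‖(s.1 - 1) i j‖ ≤ π ^ (k₂ + 1)) ∧ (∀ i j, s.2 i j ∈ A) ∧
      (∀ i j, γ • s.2 i j = s.2 i j) ∧ (∀ i j, ‖s.2 i j‖ ≤ π ^ (k₂ + k₃ + 1)) ∧
      ∀ i j, ‖(s.1⁻¹ * U * s.1.map f - 1 - s.2) i j‖ ≤ π ^ (2 * k₂ + k₃ + 1) * π ^ k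
  -- the step
  have hstep : ∀ k (s : Matrix m m (CompletedAlgClosure F) × Matrix m m (CompletedAlgClosure F)),
      I k s → ∃ s' : Matrix m m (CompletedAlgClosure F) × Matrix m m (CompletedAlgClosure F),
        I (k + 1) s' ∧ ∀ i j, ‖(s'.1 - s.1) i j‖ ≤ π ^ (k₂ + 1) * π ^ k := by
    rintro k ⟨B, Rr⟩ ⟨hBA, hB1, hRrA, hγRr, hRrM, hE⟩
    simp only at hBA hB1 hRrA hγRr hRrM hE
    have hπk0 : 0 ≤ π ^ k := pow_nonneg hπ0.le k
    have hπk1 : π ^ k ≤ 1 := pow_le_one₀ hπ0.le hπle1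
    have hEM : π⁻¹ ^ k₂ * (π ^ (2 * k₂ + k₃ + 1) * π ^ k) ≤ π ^ (k₂ + k₃ + 1) := by
      rw [num1]; exact mul_le_of_le_one_right (pow_nonneg hπ0.le _) hπk1
    have hE3 : π⁻¹ ^ k₂ * π⁻¹ ^ k₃ * (π ^ (2 * k₂ + k₃ + 1) * π ^ k) < 1 := by
      rw [num2]
      calc π ^ (k₂ + 1) * π ^ k ≤ π ^ (k₂ + 1) * 1 := mul_le_mul_of_nonneg_left hπk1 hδ0
        _ < 1 := by rw [mul_one]; exact hδ1
    obtain ⟨C, hCA, hCn, Rr', hRr'A, hγRr', hRr'M, -, -, hE'⟩ :=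
      exists_conj_near_fixed_matrix_subfield hp hγA hRA hγR hRR hRsub hc₂ hc₃ hR₂ hR₃ hRsurj
        (hUB B hBA) hRrA hγRr hRrM hEM hE3 hE
    rw [hf] at hE'
    have hCn' : ∀ i j, ‖C i j‖ ≤ π ^ (k₂ + 1) * π ^ k := fun i j =>
      (hCn i j).trans (le_of_eq (num2 k))
    have hC2 : ∀ i j, ‖C i j‖ ≤ π ^ (k₂ + 1) := fun i j =>
      (hCn' i j).trans (mul_le_of_le_one_right hδ0 hπk1)
    have hBn : ∀ i j, ‖B i j‖ ≤ 1 := hBle1 B hB1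
    have hBC : ∀ i j, ‖(B * C) i j‖ ≤ π ^ (k₂ + 1) * π ^ k := fun i j =>
      (norm_mul_apply_le zero_le_one (mul_nonneg hδ0 hπk0) hBn hCn' i j).trans
        (le_of_eq (one_mul _))
    refine ⟨⟨B * (1 + C), Rr'⟩, ⟨?_, ?_, hRr'A, hγRr', hRr'M, ?_⟩, ?_⟩
    · exact mul_apply_memA A hBA (add_apply_memA A (one_apply_memA A) hCA)
    · -- `‖B(1+C) − 1‖ ≤ π^{k₂+1}`
      intro i j
      have h : B * (1 + C) - 1 = (B - 1) + B * C := by noncomm_ring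
      simp only
      rw [h]
      exact (norm_add_apply_le hB1 hBC i j).trans
        (max_le le_rfl (mul_le_of_le_one_right hδ0 hπk1))
    · intro i j
      simp only
      rw [conj_mul_one_add' f U B C]
      exact (hE' i j).trans (le_of_eq (num3 k))
    · -- `‖B(1+C) − B‖ = ‖B C‖ ≤ π^{k₂+1} πᵏ`
      intro i j
      simp only
      have h : B * (1 + C) - B = B * C := by noncomm_ring
      rw [h]; exact hBC i j
  -- the initial state `(1, R(U − 1))`
  have hV0 : ∀ i j, (U - 1) i j ∈ A := sub_apply_memA A hU (one_apply_memA A)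
  set Rw₀ : Matrix m m (CompletedAlgClosure F) := fun i j => R ((U - 1) i j) with hRw₀_def
  have hRw₀_apply : ∀ i j, Rw₀ i j = R ((U - 1) i j) := fun i j => rfl
  have hI0 : I 0 ⟨1, Rw₀⟩ := by
    refine ⟨one_apply_memA A, fun i j => ?_, fun i j => ?_, fun i j => ?_, fun i j => ?_, fun i j => ?_⟩
    · simp only
      rw [sub_self, Matrix.zero_apply, norm_zero]; exact hδ0
    · simp only
      rw [hRw₀_apply]; exact hRA _ (hV0 i j)
    · simp only
      rw [hRw₀_apply]; exact hγR _ (hV0 i j)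
    · simp only
      rw [hRw₀_apply]
      refine (hR₂ _ (hV0 i j)).trans ?_
      calc π⁻¹ ^ k₂ * ‖(U - 1) i j‖ ≤ π⁻¹ ^ k₂ * π ^ (2 * k₂ + 2 * k₃ + 1) :=
            mul_le_mul_of_nonneg_left (hU1 i j) (pow_nonneg (inv_nonneg.mpr hπ0.le) _)
        _ = π ^ (k₂ + 2 * k₃ + 1) := num4
        _ ≤ π ^ (k₂ + k₃ + 1) := hπpow (by omega)
    · simp only
      rw [inv_one, one_mul, Matrix.map_one f (map_zero f) (map_one f), mul_one, pow_zero, mul_one,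
        Matrix.sub_apply (U - 1) Rw₀, hRw₀_apply]
      refine (hR₃ _ (hV0 i j)).trans ?_
      calc π⁻¹ ^ k₃ * ‖γ • (U - 1) i j - (U - 1) i j‖ ≤ π⁻¹ ^ k₃ * π ^ (2 * k₂ + 2 * k₃ + 1) :=
            mul_le_mul_of_nonneg_left ((norm_smul_sub_le' hp γ _).trans (hU1 i j))
              (pow_nonneg (inv_nonneg.mpr hπ0.le) _)
        _ = π ^ (2 * k₂ + k₃ + 1) := num5
  -- run the iteration
  choose! next hnext using hstep
  obtain ⟨seq, hseq0, hseqS⟩ : ∃ seq : ℕ → Matrix m m (CompletedAlgClosure F) ×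
      Matrix m m (CompletedAlgClosure F), seq 0 = ⟨1, Rw₀⟩ ∧ ∀ k, seq (k + 1) = next k (seq k) :=
    ⟨fun k => Nat.rec ⟨1, Rw₀⟩ (fun k s => next k s) k, rfl, fun _ => rfl⟩
  have hI : ∀ k, I k (seq k) := by
    intro k
    induction k with
    | zero => rw [hseq0]; exact hI0
    | succ k ih => rw [hseqS]; exact (hnext k _ ih).1
  have hdist : ∀ i j k, dist ((seq k).1 i j) ((seq (k + 1)).1 i j) ≤ π ^ (k₂ + 1) * π ^ k := by
    intro i j k
    rw [dist_comm, dist_eq_norm, hseqS, ← Matrix.sub_apply]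
    exact (hnext k _ (hI k)).2 i j
  -- entrywise limits, assembled into a matrix limit
  choose Bl hBl using fun i j =>
    cauchySeq_tendsto_of_complete (cauchySeq_of_le_geometric π (π ^ (k₂ + 1)) hπ1 (hdist i j))
  set B : Matrix m m (CompletedAlgClosure F) := fun i j => Bl i j with hB_def
  have hB_apply : ∀ i j, B i j = Bl i j := fun i j => rfl
  have hB : Tendsto (fun k => (seq k).1) atTop (𝓝 B) :=
    tendsto_pi_nhds.mpr fun i => tendsto_pi_nhds.mpr fun j => hBl i j
  -- the limit `B ∈ M_d(A)`, `‖B − 1‖ ≤ π^{k₂+1} < 1`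
  have hBA : ∀ i j, B i j ∈ A := fun i j =>
    hAc.mem_of_tendsto (hBl i j) (Eventually.of_forall fun k => (hI k).1 i j)
  have hB1 : ∀ i j, ‖(B - 1) i j‖ ≤ π ^ (k₂ + 1) := by
    intro i j
    rw [Matrix.sub_apply]
    refine le_of_tendsto ((continuous_norm.tendsto _).comp
      ((hBl i j).sub_const ((1 : Matrix m m (CompletedAlgClosure F)) i j)))
      (Eventually.of_forall fun k => ?_)
    have h := (hI k).2.1 i j
    rwa [Matrix.sub_apply] at h
  have hdetB : IsUnit B.det := isUnit_det_of_norm_sub_one_le hδ0 hδ1 hB1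
  -- `U_k = B_k⁻¹ U γ(B_k) → B⁻¹ U γ(B)`
  have hinvcont : ContinuousAt Ring.inverse B.det := by
    obtain ⟨u, hu⟩ := hdetB
    rw [← hu]; exact NormedRing.inverse_continuousAt u
  have hBinv : Tendsto (fun k => ((seq k).1)⁻¹) atTop (𝓝 B⁻¹) :=
    ((continuousAt_matrix_inv B hinvcont).tendsto).comp hB
  have hBmap : Tendsto (fun k => ((seq k).1).map f) atTop (𝓝 (B.map f)) :=
    ((continuous_id.matrix_map hγcont).tendsto B).comp hB
  have hUk : Tendsto (fun k => ((seq k).1)⁻¹ * U * ((seq k).1).map f) atTop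
      (𝓝 (B⁻¹ * U * B.map f)) := (hBinv.mul tendsto_const_nhds).mul hBmap
  refine ⟨B, hBA, hB1, hdetB, inv_apply_memA A hBA, hUB B hBA, fun i j => ?_⟩
  have hUij : Tendsto (fun k => (((seq k).1)⁻¹ * U * ((seq k).1).map f) i j) atTop
      (𝓝 ((B⁻¹ * U * B.map f) i j)) := tendsto_pi_nhds.mp (tendsto_pi_nhds.mp hUk i) j
  -- `‖γ (U_k)_{ij} − (U_k)_{ij}‖ ≤ E_k → 0`, hence `γ` fixes the limit entry
  have hsmall : ∀ k, ‖γ • (((seq k).1)⁻¹ * U * ((seq k).1).map f) i j -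
      (((seq k).1)⁻¹ * U * ((seq k).1).map f) i j‖ ≤ π ^ (2 * k₂ + k₃ + 1) * π ^ k := by
    intro k
    obtain ⟨-, -, -, hγr, -, hE⟩ := hI k
    set V := ((seq k).1)⁻¹ * U * ((seq k).1).map f
    have hVij : V i j = (V - 1 - (seq k).2) i j + (1 : Matrix m m (CompletedAlgClosure F)) i j +
        (seq k).2 i j := by
      rw [Matrix.sub_apply, Matrix.sub_apply]; ring
    have h : γ • V i j - V i j =
        γ • (V - 1 - (seq k).2) i j - (V - 1 - (seq k).2) i j := by
      rw [hVij, smul_add, smul_add, smul_one_apply' hp, hγr]; ring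
    rw [h]
    exact (norm_smul_sub_le' hp γ _).trans (hE i j)
  have hlim0 : Tendsto (fun k => γ • (((seq k).1)⁻¹ * U * ((seq k).1).map f) i j -
      (((seq k).1)⁻¹ * U * ((seq k).1).map f) i j) atTop (𝓝 0) := by
    refine squeeze_zero_norm hsmall ?_
    have h := (tendsto_pow_atTop_nhds_zero_of_lt_one hπ0.le hπ1).const_mul (π ^ (2 * k₂ + k₃ + 1))
    rw [mul_zero] at h
    exact h
  have hγcont' : Continuous fun z : CompletedAlgClosure F => γ • z :=
    CompletedAlgClosure.continuous_base_smul hp γ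
  have hlim1 : Tendsto (fun k => γ • (((seq k).1)⁻¹ * U * ((seq k).1).map f) i j -
      (((seq k).1)⁻¹ * U * ((seq k).1).map f) i j) atTop
      (𝓝 (γ • (B⁻¹ * U * B.map f) i j - (B⁻¹ * U * B.map f) i j)) :=
    ((hγcont'.tendsto _).comp hUij).sub hUij
  exact sub_eq_zero.mp (tendsto_nhds_unique hlim1 hlim0)

end TateTrace

end Literature.NumberTheory.PAdicHodge
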